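import Literature.AlgebraicGeometry.Frobenioids.ArithmeticFrobenioidThm64ivNormPreservation
import Literature.AlgebraicGeometry.Frobenioids.MotivatingExamplesThm64ivBaseCompat
import HarnessLib

/-!
# Frobenioids I, Theorem 6.4 (iv), second clause WITH the compatibility `F₁ ≅ F₂` — AT THE CONSTRUCTIONS
# (row T64iv/L07b of `plan/L1/SUBDAG-FrdI-Thm64.md` at the data; GAP-LEDGER G-L1t3-1)

Mochizuki, *The geometry of Frobenioids I: the general theory*, Kyushu J. Math. **62** (2008) 293–400, §6,
Thm. 6.4 (iv) p. 115 l. 23–29: "If, moreover, there exists a finite extension `L₁ ⊆ F̃₁` of `F₁` which is Galois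
over `ℚ`, then the corresponding [i.e., via the equivalence `D₁ ⥲ D₂` induced by `Ψ` — cf. (i); Corollary 4.11,
(ii)] finite extension `L₂ ⊆ F̃₂` of `F₂` is isomorphic to `L₁` in a fashion that is compatible with an
isomorphism `F₁ ⥲ F₂`." [cite: MochizukiFrdI2008, Thm. 6.4 (iv) p.115]

PROOF-ONLY composition (seat abc-iut-L1-d4 gen 5; 0 definitions, no named facts) of
* abc-iut-L1-d7's `arith_logNorm_transport` / `arith_residueChar_transport`
  (`ArithmeticFrobenioidThm64ivNormPreservation.lean`: an equivalence `Ψ : C_{K₁/F₁} ⥲ C_{K₂/F₂}` of THE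
  arithmetic Frobenioids, with its Cor. 4.11 (iv) datum `(Ψ^Base, Ψ^Φ = E, η, hdiv)`, PRESERVES the norms and
  residue characteristics of primes along the generator-to-generator bijections `π_X`), with
* this seat's `Thm64iv_compat_of_transport_of_isGalois_base` / `…_of_baseIso` / `Thm64iv_compat_iff`
  (`MotivatingExamplesThm64ivBaseCompat.lean`, p422145: the compatibility clause ⟺ L07a ∧ `F₁ ≅ F₂`; discharged
  when `F₁` is Galois over `ℚ`),
giving, AT THE CONSTRUCTIONS and modulo the Cor. 4.11 (iv) datum alone (abc-iut-L1-t14's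
`FrdI.exists_cor411iv_data_ofFunctor_of_isOfFSMType` delivers it at `C_{K/F}`):
* `Thm64iv_arith_compat_of_isGalois_base` — `F₁` Galois over `ℚ` (e.g. `F₁ = ℚ`): for every `X = Spec L₁` with
  `L₁` Galois over `ℚ`, `L₂ := (Ψ^Base X).L ≅ L₁` COMPATIBLY with an isomorphism `F₁ ≅ F₂` — the printed clause
  in full;
* `nonempty_baseRingEquiv_arith_of_isGalois_base` — in particular `F₁ ≅ F₂`;
* `Thm64iv_arith_compat_of_baseIso` — for arbitrary `F₁`, the clause from an isomorphism `φ : F₁ ≅ F₂`;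
* `Thm64iv_arith_compat_iff` — for arbitrary `F₁`, the printed clause holds at `X` IFF `F₁ ≅ F₂` (L07a being
  UNCONDITIONAL at the data by abc-iut-L1-d7's `Thm64iv_arith_fieldIso`): the honest residual of G-L1t3-1 at
  the data is exactly `Nonempty (F₁ ≃+* F₂)`, not argued in print for `F₁` not Galois over `ℚ`;
* (sequel `ArithmeticFrobenioidThm64ivCompatCor411.lean`: the same with the datum replaced by the TYPED cone node
  [FrdI] Cor. 4.11 (iv) for `Ψ`, via abc-iut-L1-d7's `exists_transport_of_cor411iv`.)
"`Spec F₁`" is any object `B₁` of `D₁` with `ε₁ : B₁.L ≃ₐ[F₁] F₁` (e.g. `⟨⊥⟩` with `IntermediateField.botEquiv`;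
kept as a binder — see p422145). Nothing here bears on, or takes a side on, [IUTchIII] Cor. 3.12.
-/

noncomputable section

namespace Literature.AlgebraicGeometry.Frobenioids

open CategoryTheory Opposite NumberField

section Arith

variable {F₁ : Type} [Field F₁] [NumberField F₁] {K₁ : Type} [Field K₁] [Algebra F₁ K₁] [IsGalois F₁ K₁]
variable {F₂ : Type} [Field F₂] [NumberField F₂] {K₂ : Type} [Field K₂] [Algebra F₂ K₂] [IsGalois F₂ K₂]

/-- **[FrdI] Thm. 6.4 (iv), second clause IN FULL, at the constructions — `F₁` Galois over `ℚ`**: for an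
equivalence `Ψ : C_{K₁/F₁} ⥲ C_{K₂/F₂}` of arithmetic Frobenioids with Cor. 4.11 (iv) datum `(Ψ^Base, Ψ^Φ, η)`,
an object `B₁ = Spec F₁` of `D₁`, and `X = Spec L₁` with `L₁` Galois over `ℚ`: `L₂ := (Ψ^Base X).L` is isomorphic to
`L₁` compatibly with an isomorphism `F₁ ≅ F₂`. [cite: MochizukiFrdI2008, Thm. 6.4 (iv) p.115] -/
theorem Thm64iv_arith_compat_of_isGalois_base [IsGalois ℚ F₁] (Ψ : arithFrobenioid F₁ K₁ ≌ arithFrobenioid F₂ K₂)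
    {ΨBase : FinSubextCat F₁ K₁ ⥤ FinSubextCat F₂ K₂} [ΨBase.IsEquivalence]
    (E : PreFrobenioidData.DivisorMonoidIsoOverBase (arithFrobenioidOps F₁ K₁) (arithFrobenioidOps F₂ K₂) ΨBase)
    (η : Ψ.functor ⋙ (arithFrobenioidOps F₂ K₂).base ≅ (arithFrobenioidOps F₁ K₁).base ⋙ ΨBase)
    (hdiv : ∀ ⦃A B : arithFrobenioid F₁ K₁⦄ (φ : A ⟶ B),
      (arithFrobenioidOps F₂ K₂).div (Ψ.functor.map φ) =
        (arithFrobenioidOps F₂ K₂).pull (η.hom.app A)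
          (E.iso ((arithFrobenioidOps F₁ K₁).base.obj A) ((arithFrobenioidOps F₁ K₁).div φ)))
    (B₁ : FinSubextCat F₁ K₁) (ε₁ : B₁.L ≃ₐ[F₁] F₁) (X : FinSubextCat F₁ K₁) (hX : IsGalois ℚ X.L) :
    ∃ (e : X.L ≃+* (ΨBase.obj X).L) (e₀ : F₁ ≃+* F₂),
      ∀ a : F₁, e (algebraMap F₁ X.L a) = algebraMap F₂ (ΨBase.obj X).L (e₀ a) := by
  obtain ⟨π₀, hπ₀⟩ := EffArithDivisor.exists_finitePlaceEquiv_mulEquiv (E.iso B₁)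
  obtain ⟨π, hπ⟩ := EffArithDivisor.exists_finitePlaceEquiv_mulEquiv (E.iso X)
  exact Thm64iv_compat_of_transport_of_isGalois_base ΨBase B₁ ε₁ π₀
    (arith_residueChar_transport Ψ E η hdiv B₁ π₀ hπ₀)
    (fun w => (arith_logNorm_transport Ψ E η hdiv B₁ π₀ hπ₀ w).symm) X hX π
    (arith_residueChar_transport Ψ E η hdiv X π hπ) (fun w => (arith_logNorm_transport Ψ E η hdiv X π hπ w).symm)

/-- **`F₁ ≅ F₂` at the constructions when `F₁` is Galois over `ℚ`**: an equivalence of arithmetic Frobenioids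
(with its Cor. 4.11 (iv) datum) forces an isomorphism of the base fields — print's transport argument at
`X = Spec F₁` (p422145's `nonempty_baseRingEquiv_of_isGalois_of_transport` fed with abc-iut-L1-d7's norm
preservation). [cite: MochizukiFrdI2008, Thm. 6.4 (iv) p.115] -/
theorem nonempty_baseRingEquiv_arith_of_isGalois_base [IsGalois ℚ F₁]
    (Ψ : arithFrobenioid F₁ K₁ ≌ arithFrobenioid F₂ K₂)
    {ΨBase : FinSubextCat F₁ K₁ ⥤ FinSubextCat F₂ K₂} [ΨBase.IsEquivalence]
    (E : PreFrobenioidData.DivisorMonoidIsoOverBase (arithFrobenioidOps F₁ K₁) (arithFrobenioidOps F₂ K₂) ΨBase)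
    (η : Ψ.functor ⋙ (arithFrobenioidOps F₂ K₂).base ≅ (arithFrobenioidOps F₁ K₁).base ⋙ ΨBase)
    (hdiv : ∀ ⦃A B : arithFrobenioid F₁ K₁⦄ (φ : A ⟶ B),
      (arithFrobenioidOps F₂ K₂).div (Ψ.functor.map φ) =
        (arithFrobenioidOps F₂ K₂).pull (η.hom.app A)
          (E.iso ((arithFrobenioidOps F₁ K₁).base.obj A) ((arithFrobenioidOps F₁ K₁).div φ)))
    (B₁ : FinSubextCat F₁ K₁) (ε₁ : B₁.L ≃ₐ[F₁] F₁) : Nonempty (F₁ ≃+* F₂) := by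
  obtain ⟨π₀, hπ₀⟩ := EffArithDivisor.exists_finitePlaceEquiv_mulEquiv (E.iso B₁)
  exact nonempty_baseRingEquiv_of_isGalois_of_transport ΨBase B₁ ε₁ π₀
    (arith_residueChar_transport Ψ E η hdiv B₁ π₀ hπ₀)
    (fun w => (arith_logNorm_transport Ψ E η hdiv B₁ π₀ hπ₀ w).symm)

/-- **Thm. 6.4 (iv), second clause at the constructions, from an isomorphism `φ : F₁ ≅ F₂`** (no hypothesis on
`F₁/ℚ`): at every `X = Spec L₁` with `L₁` Galois over `ℚ`, abc-iut-L1-d7's field isomorphism `L₁ ≅ L₂` is replaced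
by one compatible with `φ`. [cite: MochizukiFrdI2008, Thm. 6.4 (iv) p.115] -/
theorem Thm64iv_arith_compat_of_baseIso (Ψ : arithFrobenioid F₁ K₁ ≌ arithFrobenioid F₂ K₂)
    {ΨBase : FinSubextCat F₁ K₁ ⥤ FinSubextCat F₂ K₂} [ΨBase.IsEquivalence]
    (E : PreFrobenioidData.DivisorMonoidIsoOverBase (arithFrobenioidOps F₁ K₁) (arithFrobenioidOps F₂ K₂) ΨBase)
    (η : Ψ.functor ⋙ (arithFrobenioidOps F₂ K₂).base ≅ (arithFrobenioidOps F₁ K₁).base ⋙ ΨBase)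
    (hdiv : ∀ ⦃A B : arithFrobenioid F₁ K₁⦄ (φ : A ⟶ B),
      (arithFrobenioidOps F₂ K₂).div (Ψ.functor.map φ) =
        (arithFrobenioidOps F₂ K₂).pull (η.hom.app A)
          (E.iso ((arithFrobenioidOps F₁ K₁).base.obj A) ((arithFrobenioidOps F₁ K₁).div φ)))
    (φ : F₁ ≃+* F₂) (X : FinSubextCat F₁ K₁) (hX : IsGalois ℚ X.L) :
    ∃ (e : X.L ≃+* (ΨBase.obj X).L) (e₀ : F₁ ≃+* F₂),
      ∀ a : F₁, e (algebraMap F₁ X.L a) = algebraMap F₂ (ΨBase.obj X).L (e₀ a) := by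
  obtain ⟨e₁⟩ := Thm64iv_arith_fieldIso Ψ E η hdiv X hX
  exact Thm64iv_compat_of_fieldIso_of_baseIso ΨBase X hX e₁ φ

/-- **The status of the printed clause AT THE CONSTRUCTIONS (GAP G-L1t3-1, sharpened)**: for an arbitrary
number field `F₁`, at every `X = Spec L₁` with `L₁` Galois over `ℚ` the clause "`L₂ ≅ L₁` compatibly with an
isomorphism `F₁ ≅ F₂`" holds IF AND ONLY IF `F₁ ≅ F₂` as fields — the isomorphism `L₁ ≅ L₂` itself being
unconditional at the data (abc-iut-L1-d7's `Thm64iv_arith_fieldIso`).  For `F₁` Galois over `ℚ` the right-hand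
side holds (`nonempty_baseRingEquiv_arith_of_isGalois_base`); for general `F₁` it is not argued in print.
[cite: MochizukiFrdI2008, Thm. 6.4 (iv) p.115] -/
theorem Thm64iv_arith_compat_iff (Ψ : arithFrobenioid F₁ K₁ ≌ arithFrobenioid F₂ K₂)
    {ΨBase : FinSubextCat F₁ K₁ ⥤ FinSubextCat F₂ K₂} [ΨBase.IsEquivalence]
    (E : PreFrobenioidData.DivisorMonoidIsoOverBase (arithFrobenioidOps F₁ K₁) (arithFrobenioidOps F₂ K₂) ΨBase)
    (η : Ψ.functor ⋙ (arithFrobenioidOps F₂ K₂).base ≅ (arithFrobenioidOps F₁ K₁).base ⋙ ΨBase)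
    (hdiv : ∀ ⦃A B : arithFrobenioid F₁ K₁⦄ (φ : A ⟶ B),
      (arithFrobenioidOps F₂ K₂).div (Ψ.functor.map φ) =
        (arithFrobenioidOps F₂ K₂).pull (η.hom.app A)
          (E.iso ((arithFrobenioidOps F₁ K₁).base.obj A) ((arithFrobenioidOps F₁ K₁).div φ)))
    (X : FinSubextCat F₁ K₁) (hX : IsGalois ℚ X.L) :
    (∃ (e : X.L ≃+* (ΨBase.obj X).L) (e₀ : F₁ ≃+* F₂),
        ∀ a : F₁, e (algebraMap F₁ X.L a) = algebraMap F₂ (ΨBase.obj X).L (e₀ a)) ↔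
      Nonempty (F₁ ≃+* F₂) := by
  rw [Thm64iv_compat_iff ΨBase X hX]
  exact ⟨fun h => h.2, fun h => ⟨Thm64iv_arith_fieldIso Ψ E η hdiv X hX, h⟩⟩


end Arith

end Literature.AlgebraicGeometry.Frobenioids

end
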